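import Literature.Probability.RandomPlanarGeometry.HexSAWBrickWallStripFugacityLevel0Locality
import Mathlib.Analysis.SpecialFunctions.Pow.Continuity
import HarnessLib

/-!
# The printed strip rates grow at most like `√y`: `μ_T(y',1) ≤ √(y'/y) · μ_T(y,1)` for every strip width `T` and `0 < y ≤ y'`

Topic `Literature/Probability/RandomPlanarGeometry` (continues `HexSAWBrickWallStripFugacityLevel0.lean` / `…Level0Locality.lean` — the PRINTED one-level
surface weight of Beaton–Bousquet-Mélou–de Gier–Duminil-Copin–Guttmann: `HexBW.bottomVisits₀` (level-`0` vertices = bottom row ∧ odd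
abscissa), `C_{T,n}(y,1) = HexBW.stripZ₀ T n y`, `μ_T(y,1) = HexBW.stripMuY₀ T y` with `tendsto_stripZ₀_rpow`, and the zig-zag
lower bound `sqrt_le_stripMuY₀ : 1 ≤ y → √y ≤ μ_T(y,1)`).

Source of the frame.  N. R. Beaton, M. Bousquet-Mélou, J. de Gier, H. Duminil-Copin, A. J. Guttmann, CMP 326 (2014), §3.2,
Proposition 6 (arXiv:1109.0358v5 p. 10: "`μ_T(y,z)` is finite, and non-decreasing in `y` and `z` … log-convex") and the proof of
Corollary 8 (p. 12: "`ρ_T(y) ≤ 1/√y` as can be seen by counting zig-zag paths").  What is added here is the matching UPPER growth: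
two LEVEL-`0` vertices of the brick wall are never adjacent (a horizontal bond changes the parity of the abscissa, a vertical bond
the row), so a walk meets the bottom level at most at every other time — `bottomVisits₀ ≤ n/2 + 1` (`bottomVisits₀_le_div_two_succ`)
— and therefore each summand `y^{bc(ω)}` of `C_{T,n}(y,1)` grows at most like `y^{n/2+1}`: **`μ_T(y',1) ≤ √(y'/y) · μ_T(y,1)`** for
`0 < y ≤ y'` (`stripMuY₀_le_sqrt_mul`), i.e. `μ_T(y,1)/√y` is non-increasing in `y` for every `T` (`antitoneOn_stripMuY₀_div_sqrt`).
This is the strip companion of the half-plane statement for the wall-bridge rate (`HexSAWSurfaceWallRateSqrtMonotone.lean`, lane);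
it passes to the limit `T → ∞` (BBdGDCG14 Prop. 7, second sentence) unchanged.  Label (lane «pcv-sawmu»): an elementary COROLLARY of the
printed objects' parity structure, not found stated in print (NEW-IN-WRITING, modest at most).

## Contents (namespace `Literature.Probability.RandomPlanarGeometry.SAW.HexBW`, all PROVED)

* `not_level0_succ` — consecutive vertices of a brick-wall walk are not both level-`0` vertices;
* `bottomVisits₀_le_div_two_succ` — `bottomVisits₀ a υ n ≤ n / 2 + 1` for every brick-wall walk;
* `stripZ₀_le_pow_half_mul` — `C_{T,n}(y',1) ≤ (y'/y)^{n/2+1} · C_{T,n}(y,1)` for `0 < y ≤ y'`;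
* **`stripMuY₀_le_sqrt_mul`** — `μ_T(y',1) ≤ √(y'/y) · μ_T(y,1)`; `antitoneOn_stripMuY₀_div_sqrt`;
* `stripMuY₀_le_sqrt_mul_one` — `1 ≤ y → μ_T(y,1) ≤ √y · μ_T(1,1)`, and **`stripMuY₀_mem_Icc_sqrt`** — `1 ≤ y → μ_T(y,1) ∈ [√y, √y · μ_ℍ]`
  for EVERY `T` (with the tree's `sqrt_le_stripMuY₀` and `stripMuY₀_le_hexConnectiveConstant` of `…Level0Locality.lean`).
-/

noncomputable section

open Filter Topology Finset Literature.Probability.LatticeModels Literature.Probability.Percolation SimpleGraph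

namespace Literature.Probability.RandomPlanarGeometry.SAW.HexBW

variable {y : ℝ}

/-! ### Level-`0` vertices are never adjacent -/

/-- Two level-`0` vertices (row `0`, odd abscissa) of the brick wall are never adjacent: consecutive vertices of a brick-wall walk are
not both of level `0`. [cite: DuminilCopinSmirnov2012, §3 (Fig. 3: the levels of the strip); EntingJensen2009, §7.4.2, Fig. 7.10 (brickwork form of the honeycomb lattice)] -/
theorem not_level0_succ {x z : Site 2} (h : brickWallGraph.Adj x z) (hx : x 1 = 0 ∧ x 0 % 2 = 1) :
    ¬ (z 1 = 0 ∧ z 0 % 2 = 1) := by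
  rintro ⟨hz1, hz0⟩
  rw [brickWallGraph_adj_coord] at h
  omega

/-- **`bottomVisits₀ a υ n ≤ n/2 + 1`** for every placed brick-wall walk `m ↦ a + υ m`: the bottom level is met at most at every other
time. [cite: BeatonBousquetMelouDeGierDuminilCopinGuttmann2014, proof of Corollary 8 (arXiv v5 p. 12: zig-zag paths along the bottom line realise the extreme)] -/
theorem bottomVisits₀_le_div_two_succ (a : Site 2) (υ : ℕ → Site 2) {n : ℕ} (hbw : IsBW n fun i => a + υ i) :
    bottomVisits₀ a υ n ≤ n / 2 + 1 := by
  -- the indicator of a level-0 visit at time `m`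
  set P : ℕ → Prop := fun m => (a + υ m) 1 = 0 ∧ (a + υ m) 0 % 2 = 1 with hP
  have key : ∀ m, m < n → P m → ¬ P (m + 1) := fun m hm hPm => by
    have h := hbw m hm
    exact not_level0_succ h hPm
  -- partial sums `S k = #{m < k : P m}` satisfy `S (k+2) ≤ S k + 1`
  have hsum : ∀ k, k + 1 ≤ n →
      (∑ m ∈ Finset.range (k + 2), if P m then 1 else 0) ≤ (∑ m ∈ Finset.range k, if P m then 1 else 0) + 1 := by
    intro k hk
    rw [Finset.sum_range_succ, Finset.sum_range_succ]
    by_cases h1 : P k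
    · have h2 : ¬ P (k + 1) := key k (by omega) h1
      simp [h1, h2]
    · by_cases h2 : P (k + 1)
      · simp [h1, h2]
      · simp [h1, h2]
  -- induction in steps of two
  have main : ∀ k, k ≤ n + 1 → (∑ m ∈ Finset.range k, if P m then 1 else 0) ≤ k / 2 + k % 2 := by
    intro k
    induction k using Nat.twoStepInduction with
    | zero => intro; simp
    | one => intro; simp only [Finset.sum_range_one]; split_ifs <;> simp
    | more k ih _ =>
      intro hk
      have h := hsum k (by omega)
      have := ih (by omega)
      have e : (k + 2) / 2 + (k + 2) % 2 = k / 2 + k % 2 + 1 := by omega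
      omega
  have h := main (n + 1) le_rfl
  unfold bottomVisits₀
  have e : n / 2 + 1 = (n + 1) / 2 + (n + 1) % 2 := by omega
  rw [e]
  convert h using 2

/-! ### The finite-`n` comparison -/

/-- **`C_{T,n}(y',1) ≤ (y'/y)^{n/2+1} · C_{T,n}(y,1)` for `0 < y ≤ y'`** (term by term, `bc(ω) ≤ n/2 + 1`; the half-exponent
sharpening of `stripZ₀_le_pow_mul` — exponent `n+1` — of `HexSAWBrickWallStripFugacityLevel0Prop6.lean`).
[cite: BeatonBousquetMelouDeGierDuminilCopinGuttmann2014, §3.2, Proposition 6 (arXiv v5 p. 10: C_{T,k}(y,z) = Σ y^{bc(ω)} z^{tc(ω)})] -/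
theorem stripZ₀_le_pow_half_mul (T n : ℕ) (hy : 0 < y) {y' : ℝ} (hyy' : y ≤ y') :
    stripZ₀ T n y' ≤ (y' / y) ^ (n / 2 + 1) * stripZ₀ T n y := by
  have hq : 1 ≤ y' / y := (one_le_div hy).2 hyy'
  unfold stripZ₀
  rw [Finset.mul_sum]
  refine Finset.sum_le_sum fun p hp => ?_
  have hbw := (mem_stripPairs.1 hp).2.2.1
  have hb : bottomVisits₀ p.1 p.2 n ≤ n / 2 + 1 := bottomVisits₀_le_div_two_succ p.1 p.2 hbw
  have e : y' ^ bottomVisits₀ p.1 p.2 n = (y' / y) ^ bottomVisits₀ p.1 p.2 n * y ^ bottomVisits₀ p.1 p.2 n := by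
    rw [← mul_pow, div_mul_cancel₀ _ hy.ne']
  rw [e]
  exact mul_le_mul_of_nonneg_right (pow_le_pow_right₀ hq hb) (pow_nonneg hy.le _)

/-! ### The limit: `μ_T(y',1) ≤ √(y'/y) · μ_T(y,1)` -/

/-- The prefactor: `((y'/y)^{n/2+1})^{1/n} → √(y'/y)` as `n → ∞`, here in the `≤` form
`((y'/y)^{n/2+1})^{1/n} ≤ (y'/y)^{1/2 + 1/n}` with the right-hand side tending to `√(y'/y)`.
[cite: MadrasSlade1993, §1.2 (Fekete's lemma: n-th roots)] -/
theorem tendsto_rpow_half_add_inv {q : ℝ} (hq : 0 < q) :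
    Tendsto (fun n : ℕ => q ^ (1 / 2 + 1 / (n : ℝ))) atTop (𝓝 (Real.sqrt q)) := by
  have h1 : Tendsto (fun n : ℕ => (1 : ℝ) / 2 + 1 / (n : ℝ)) atTop (𝓝 (1 / 2)) := by
    have := tendsto_const_div_atTop_nhds_zero_nat (1 : ℝ)
    simpa using this.const_add (1 / 2 : ℝ)
  have h2 := (Real.continuousAt_const_rpow hq.ne').tendsto.comp h1
  rw [Real.sqrt_eq_rpow]
  exact h2

/-- **`μ_T(y',1) ≤ √(y'/y) · μ_T(y,1)` for every `T` and `0 < y ≤ y'`**: the printed strip rate grows at most like `√y`.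
[cite: BeatonBousquetMelouDeGierDuminilCopinGuttmann2014, §3.2, Proposition 6 (arXiv v5 p. 10) and proof of Corollary 8 (p. 12: ρ_T(y) ≤ 1/√y)] -/
theorem stripMuY₀_le_sqrt_mul (T : ℕ) (hy : 0 < y) {y' : ℝ} (hyy' : y ≤ y') :
    stripMuY₀ T y' ≤ Real.sqrt (y' / y) * stripMuY₀ T y := by
  have hy' : 0 < y' := lt_of_lt_of_le hy hyy'
  set q := y' / y with hqdef
  have hq1 : 1 ≤ q := (one_le_div hy).2 hyy'
  have hq0 : 0 < q := lt_of_lt_of_le one_pos hq1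
  -- the two limits
  have hL := tendsto_stripZ₀_rpow T hy'
  have hR : Tendsto (fun n : ℕ => q ^ (1 / 2 + 1 / (n : ℝ)) * (stripZ₀ T n y) ^ (1 / (n : ℝ))) atTop
      (𝓝 (Real.sqrt q * stripMuY₀ T y)) := (tendsto_rpow_half_add_inv hq0).mul (tendsto_stripZ₀_rpow T hy)
  refine le_of_tendsto_of_tendsto hL hR ?_
  filter_upwards [Filter.eventually_ge_atTop 1] with n hn
  have hn0 : (0 : ℝ) < n := by exact_mod_cast hn
  have hZ := stripZ₀_le_pow_half_mul T n hy hyy'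
  have hZ0 : 0 ≤ stripZ₀ T n y' := (stripZ₀_pos T n hy').le
  -- take `n`-th roots
  have h1 : stripZ₀ T n y' ^ (1 / (n : ℝ)) ≤ ((q ^ (n / 2 + 1) * stripZ₀ T n y)) ^ (1 / (n : ℝ)) :=
    Real.rpow_le_rpow hZ0 hZ (by positivity)
  have h2 : (q ^ (n / 2 + 1) * stripZ₀ T n y) ^ (1 / (n : ℝ)) =
      (q ^ (n / 2 + 1)) ^ (1 / (n : ℝ)) * (stripZ₀ T n y) ^ (1 / (n : ℝ)) :=
    Real.mul_rpow (pow_nonneg hq0.le _) (stripZ₀_pos T n hy).le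
  -- the prefactor: `(q^{⌊n/2⌋+1})^{1/n} ≤ q^{1/2 + 1/n}`
  have h3 : (q ^ (n / 2 + 1)) ^ (1 / (n : ℝ)) ≤ q ^ (1 / 2 + 1 / (n : ℝ)) := by
    rw [← Real.rpow_natCast q (n / 2 + 1), ← Real.rpow_mul hq0.le]
    refine Real.rpow_le_rpow_of_exponent_le hq1 ?_
    have hd : (((n / 2 + 1 : ℕ)) : ℝ) ≤ (n : ℝ) / 2 + 1 := by
      have : ((n / 2 : ℕ) : ℝ) ≤ (n : ℝ) / 2 := by
        rw [le_div_iff₀ (by norm_num : (0:ℝ) < 2)]; exact_mod_cast Nat.div_mul_le_self n 2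
      push_cast; linarith
    calc (((n / 2 + 1 : ℕ)) : ℝ) * (1 / (n : ℝ)) ≤ ((n : ℝ) / 2 + 1) * (1 / (n : ℝ)) :=
          mul_le_mul_of_nonneg_right hd (by positivity)
      _ = 1 / 2 + 1 / (n : ℝ) := by field_simp
  calc stripZ₀ T n y' ^ (1 / (n : ℝ)) ≤ (q ^ (n / 2 + 1)) ^ (1 / (n : ℝ)) * (stripZ₀ T n y) ^ (1 / (n : ℝ)) := h2 ▸ h1
    _ ≤ q ^ (1 / 2 + 1 / (n : ℝ)) * (stripZ₀ T n y) ^ (1 / (n : ℝ)) :=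
        mul_le_mul_of_nonneg_right h3 (Real.rpow_nonneg (stripZ₀_pos T n hy).le _)

/-- **`μ_T(y,1)/√y` is non-increasing on `(0, ∞)`** for every `T`.
[cite: BeatonBousquetMelouDeGierDuminilCopinGuttmann2014, §3.2, Proposition 6 (arXiv v5 p. 10)] -/
theorem antitoneOn_stripMuY₀_div_sqrt (T : ℕ) : AntitoneOn (fun y : ℝ => stripMuY₀ T y / Real.sqrt y) (Set.Ioi 0) := by
  intro y hy y' _ hyy'
  have hy0 : (0:ℝ) < y := hy
  have hy' : 0 < y' := lt_of_lt_of_le hy0 hyy'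
  have h := stripMuY₀_le_sqrt_mul T hy0 hyy'
  have hsy' : 0 < Real.sqrt y' := Real.sqrt_pos.2 hy'
  rw [Real.sqrt_div hy'.le] at h
  show stripMuY₀ T y' / Real.sqrt y' ≤ stripMuY₀ T y / Real.sqrt y
  rw [div_le_iff₀ hsy']
  calc stripMuY₀ T y' ≤ Real.sqrt y' / Real.sqrt y * stripMuY₀ T y := h
    _ = stripMuY₀ T y / Real.sqrt y * Real.sqrt y' := by ring

/-! ### Uniform-in-`T` consequences for `y ≥ 1` -/

/-- `μ_T(y,1) ≤ √y · μ_T(1,1)` for `y ≥ 1` and every `T`. [cite: BeatonBousquetMelouDeGierDuminilCopinGuttmann2014, §3.2, Proposition 6 (arXiv v5 p. 10)] -/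
theorem stripMuY₀_le_sqrt_mul_one (T : ℕ) (hy : 1 ≤ y) : stripMuY₀ T y ≤ Real.sqrt y * stripMuY₀ T 1 := by
  have h := stripMuY₀_le_sqrt_mul T one_pos hy
  rwa [div_one] at h

/-- **The window `√y ≤ μ_T(y,1) ≤ √y · μ_ℍ` for every `T` and `y ≥ 1`** (lower end: the zig-zag walks of the proof of Corollary 8;
upper end: the parity bound and `μ_T(1,1) = μ(S_T) ≤ μ_ℍ`).
[cite: BeatonBousquetMelouDeGierDuminilCopinGuttmann2014, proof of Corollary 8 (arXiv v5 p. 12: ρ_T(y) ≤ 1/√y) and §3.2, Proposition 6 (p. 10); MadrasSlade1993, §8.2, (8.2.2)–(8.2.3) p. 267 (μ(S_T) by submultiplicativity; μ(S_T) ≤ μ immediate)] -/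
theorem stripMuY₀_mem_Icc_sqrt (T : ℕ) (hy : 1 ≤ y) :
    stripMuY₀ T y ∈ Set.Icc (Real.sqrt y) (Real.sqrt y * hexConnectiveConstant) := by
  refine ⟨sqrt_le_stripMuY₀ T hy, (stripMuY₀_le_sqrt_mul_one T hy).trans ?_⟩
  exact mul_le_mul_of_nonneg_left (stripMuY₀_le_hexConnectiveConstant T one_pos le_rfl) (Real.sqrt_nonneg _)

end Literature.Probability.RandomPlanarGeometry.SAW.HexBW
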